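import Mathlib
import Literature.Analysis.FluidPDE.SteadyNSLatticePersistenceDrift
import HarnessLib

/-!
# Stub `stub_linearisationInjective` of crux `WindLine.WindyGalerkinSteadyZerothLaw`
# (stmt-AnomalousDissipation-11414), line `registered`

Injectivity of the leaf linearisation `4π²ν + (D + K)` on the state space `W ⊂ ℓ²(ℤ³; ℂ³)` at a
leaf-nondegenerate classical steady state: §5 of
`Literature.Analysis.FluidPDE.SteadyLatticeDrift.steadyPersistsInLeaf_of_nondeg`, extracted for a
general smooth divergence-free `u` (the force never enters). With `a = 𝓕u`, base point `x₀`
(`cf x₀ = a°`, the punctured family), bilinear map `B` (coordinates `Π N(x̌, y̌)`), drift `D`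
(coordinates `2πi (k·a(0)) x̌(k)`) and `K w = B(x₀,w) + B(w,x₀)`, a kernel vector `w` of
`4π²ν + (D + K)` solves, in coordinates and after `leray_nl_linearised_update`, the linearised
lattice equation against the FULL family `a`; hence `cf w` decays rapidly
(`SteadyLattice.rapidDecay_of_linearised_eq`) and, if non-zero, synthesises a classical mean-zero
eigenvector of `L(ν,u)` for the eigenvalue `0` (`SteadyLattice.isLinNSEigenvalue_of_fourier`),
which `¬ IsLinNSEigenvalue ν u 0` excludes.
-/

noncomputable section

-- D-0017: single-problem summit ⇒ the duplicated namespace segment is by design.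
set_option linter.dupNamespace false

open scoped InnerProductSpace Topology ComplexConjugate
open MeasureTheory Filter UnitAddTorus
open Literature.Analysis.FunctionSpaces Literature.Analysis.FunctionSpaces.Torus
open Literature.Analysis.FunctionSpaces.EuclideanSpace
open Literature.Analysis.FluidPDE Literature.Analysis.FluidPDE.Torus
open Literature.Analysis.FluidPDE.ScalarFourier
open Literature.Analysis.FluidPDE.SteadyLattice Literature.Analysis.FluidPDE.SteadyLatticeDrift

namespace Summit.AnomalousDissipation.AnomalousDissipation.Theorems.WindLineWindyGalerkinSteadyZerothLaw

/-- The flat three-torus (local notation). -/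
local notation "𝕋³" => UnitAddTorus (Fin 3)
/-- Velocity values (local notation). -/
local notation "E³" => EuclideanSpace ℝ (Fin 3)
/-- Complex coefficient vectors (local notation). -/
local notation "ℂ³" => EuclideanSpace ℂ (Fin 3)
/-- Square-summable coefficient families `ℤ³ → ℂ³` (local notation). -/
local notation "ℓ2" => lp (fun _ : Fin 3 → ℤ => EuclideanSpace ℂ (Fin 3)) 2
/-- Physical coefficients `x̌(k) = x(k)/|k|²` of a family (local notation, the tree's `cf`). -/
local notation "cf[" X "]" => ((fun mm : Fin 3 → ℤ => (((freqNormSq mm)⁻¹ : ℝ) : ℂ)) • (X : (Fin 3 → ℤ) → EuclideanSpace ℂ (Fin 3)))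
/-- `k · v = ∑ⱼ kⱼ vⱼ` (local notation, the tree's `kdot`). -/
local notation "kdot[" k "," v "]" => (∑ jj : Fin 3, (((k : Fin 3 → ℤ) jj : ℤ) : ℂ) * (v : EuclideanSpace ℂ (Fin 3)) jj)
/-- The convective symbol `N(a, b)(k)` as a vector of `ℂ³` (local notation, the tree's `nl`). -/
local notation "nl[" a "," b "," k "]" =>
  ((WithLp.toLp 2 (fun pp : Fin 3 => transportSym (fun jj mm => (a : (Fin 3 → ℤ) → EuclideanSpace ℂ (Fin 3)) mm jj)
    (fun mm => (b : (Fin 3 → ℤ) → EuclideanSpace ℂ (Fin 3)) mm pp) k)) : EuclideanSpace ℂ (Fin 3))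

/-- **Coordinates of a kernel vector.** If `(4π²ν) w + (D + K) w = 0` in `W`, then at every
frequency `k` the family `w` solves the linearised steady lattice equation against the FULL
Fourier family `a = 𝓕u`:
`4π²ν w(k) + Π_k (N(a, w̌) + N(w̌, a))(k) = 0` (the drift `2πi (k·a(0)) w̌(k)` is
`Π_k N(δ₀ a(0), w̌)(k)`, `leray_nl_linearised_update`). -/
theorem coord_of_kernel (W : Submodule ℝ ℓ2)
    (hW : ∀ x : ℓ2, x ∈ W ↔ ((x : (Fin 3 → ℤ) → ℂ³) 0 = 0 ∧
      (∀ kk : Fin 3 → ℤ, kdot[kk, (x : (Fin 3 → ℤ) → ℂ³) kk] = 0) ∧ IsConjSymm (x : (Fin 3 → ℤ) → ℂ³)))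
    (B : W → W → W)
    (hB : ∀ x y : W, (((B x y : W) : ℓ2) : (Fin 3 → ℤ) → ℂ³) = fun k =>
      lerayCoeff k nl[cf[((x : ℓ2) : (Fin 3 → ℤ) → ℂ³)], cf[((y : ℓ2) : (Fin 3 → ℤ) → ℂ³)], k])
    (ν : ℝ) (u : 𝕋³ → E³) (D K : W →L[ℝ] W) (x₀ : W) (hu : IsSmooth u)
    (hD : ∀ x : W, (((D x : W) : ℓ2) : (Fin 3 → ℤ) → ℂ³) = fun k =>
      (2 * Real.pi * Complex.I * kdot[k, mFourierCoeff (complexify ∘ u) 0]) • cf[((x : ℓ2) : (Fin 3 → ℤ) → ℂ³)] k)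
    (hKw : ∀ w, K w = B x₀ w + B w x₀)
    (hcf : cf[((x₀ : ℓ2) : (Fin 3 → ℤ) → ℂ³)] = Function.update (mFourierCoeff (complexify ∘ u)) 0 0)
    (w : W) (hw0 : (4 * Real.pi ^ 2 * ν) • w + (D + K) w = 0) (k : Fin 3 → ℤ) :
    (((4 * Real.pi ^ 2 * ν : ℝ)) : ℂ) • ((w : ℓ2) : (Fin 3 → ℤ) → ℂ³) k +
      lerayCoeff k (nl[mFourierCoeff (complexify ∘ u), cf[((w : ℓ2) : (Fin 3 → ℤ) → ℂ³)], k] +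
        nl[cf[((w : ℓ2) : (Fin 3 → ℤ) → ℂ³)], mFourierCoeff (complexify ∘ u), k]) = 0 := by
  have har : RapidDecay (mFourierCoeff (complexify ∘ u)) := hu.complexify_comp.rapidDecay_mFourierCoeff
  have h := congrArg (fun z : W => (((z : W) : ℓ2) : (Fin 3 → ℤ) → ℂ³) k) hw0
  dsimp only at h
  rw [coeW_add, add_apply, coeW_add, hKw, coeW_add, coeW_smul, hB, hB, hD, hcf] at h
  simp only [Pi.add_apply, Pi.smul_apply] at h
  rw [← Complex.coe_smul, Submodule.coe_zero] at h
  rw [leray_nl_linearised_update har (w : ℓ2) (W_trans hW w) k]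
  calc _ = (((4 * Real.pi ^ 2 * ν : ℝ)) : ℂ) • ((w : ℓ2) : (Fin 3 → ℤ) → ℂ³) k +
        ((2 * Real.pi * Complex.I * kdot[k, mFourierCoeff (complexify ∘ u) 0]) •
            cf[((w : ℓ2) : (Fin 3 → ℤ) → ℂ³)] k +
          (lerayCoeff k nl[Function.update (mFourierCoeff (complexify ∘ u)) 0 0,
              cf[((w : ℓ2) : (Fin 3 → ℤ) → ℂ³)], k] +
            lerayCoeff k nl[cf[((w : ℓ2) : (Fin 3 → ℤ) → ℂ³)],
              Function.update (mFourierCoeff (complexify ∘ u)) 0 0, k])) := by abel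
    _ = _ := h

/-- **A non-zero element of `W` has non-zero physical coefficients**: `cf w = 0 → w = 0` on `W`
(the zero mode of `w` vanishes and `|k|² ≠ 0` for `k ≠ 0`). -/
theorem eq_zero_of_cf_eq_zero (W : Submodule ℝ ℓ2)
    (hW : ∀ x : ℓ2, x ∈ W ↔ ((x : (Fin 3 → ℤ) → ℂ³) 0 = 0 ∧
      (∀ kk : Fin 3 → ℤ, kdot[kk, (x : (Fin 3 → ℤ) → ℂ³) kk] = 0) ∧ IsConjSymm (x : (Fin 3 → ℤ) → ℂ³)))
    (w : W) (hz : cf[((w : ℓ2) : (Fin 3 → ℤ) → ℂ³)] = 0) : w = 0 := by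
  refine Subtype.ext (lp.ext (funext fun k => ?_))
  rw [Submodule.coe_zero]
  change ((w : ℓ2) : (Fin 3 → ℤ) → ℂ³) k = 0
  by_cases hk : k = 0
  · subst hk; exact W_zero hW w
  · have h := congrFun hz k
    rw [cf_apply, Pi.zero_apply, smul_eq_zero] at h
    rcases h with h | h
    · exfalso
      have hf : freqNormSq k ≠ 0 := ne_of_gt (lt_of_lt_of_le one_pos (one_le_freqNormSq' hk))
      exact hf (inv_eq_zero.1 (by exact_mod_cast h))
    · exact h

/-- **Stub 4 — the leaf linearisation at a leaf-nondegenerate classical steady state is injective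
on `W`** (Temam 1979 Ch. II §1 Thm. 1.3; §5 of `SteadyLatticeDrift.steadyPersistsInLeaf_of_nondeg`,
which is force-free). With `a = 𝓕u`, base point `x₀` (`cf x₀ = a°`, the punctured family),
bilinear map `B` of `exists_bilinear`, drift `D` of `exists_drift` for the mean `a 0`, and
`K w = B(x₀,w) + B(w,x₀)`: a kernel vector `w` of `4π²ν + (D + K)` has rapidly decaying physical
coefficients (`SteadyLattice.rapidDecay_of_linearised_eq`, after `leray_nl_linearised_update`),
hence synthesises a classical mean-zero eigenvector (`isLinNSEigenvalue_of_fourier`) — excluded. -/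
theorem stub_linearisationInjective :
    ∀ (W : Submodule ℝ ℓ2)
      (_hW : ∀ x : ℓ2, x ∈ W ↔ ((x : (Fin 3 → ℤ) → ℂ³) 0 = 0 ∧
        (∀ kk : Fin 3 → ℤ, kdot[kk, (x : (Fin 3 → ℤ) → ℂ³) kk] = 0) ∧ IsConjSymm (x : (Fin 3 → ℤ) → ℂ³)))
      (B : W → W → W)
      (_hB : ∀ x y : W, (((B x y : W) : ℓ2) : (Fin 3 → ℤ) → ℂ³) = fun k =>
        lerayCoeff k nl[cf[((x : ℓ2) : (Fin 3 → ℤ) → ℂ³)], cf[((y : ℓ2) : (Fin 3 → ℤ) → ℂ³)], k])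
      (ν : ℝ) (u : 𝕋³ → E³) (D K : W →L[ℝ] W) (x₀ : W),
      0 < ν → IsSmooth u → IsDivFree u → ¬ IsLinNSEigenvalue ν u 0 →
      (∀ x : W, (((D x : W) : ℓ2) : (Fin 3 → ℤ) → ℂ³) = fun k =>
        (2 * Real.pi * Complex.I * kdot[k, mFourierCoeff (complexify ∘ u) 0]) • cf[((x : ℓ2) : (Fin 3 → ℤ) → ℂ³)] k) →
      (∀ w, K w = B x₀ w + B w x₀) →
      cf[((x₀ : ℓ2) : (Fin 3 → ℤ) → ℂ³)] = Function.update (mFourierCoeff (complexify ∘ u)) 0 0 →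
      ∀ w : W, (4 * Real.pi ^ 2 * ν) • w + (D + K) w = 0 → w = 0 := by
  intro W hW B hB ν u D K x₀ hν hu hdiv hnd hD hKw hcf w hw0
  have har : RapidDecay (mFourierCoeff (complexify ∘ u)) := hu.complexify_comp.rapidDecay_mFourierCoeff
  have hat : ∀ m : Fin 3 → ℤ, kdot[m, mFourierCoeff (complexify ∘ u) m] = 0 := fun m =>
    hdiv.sum_mul_mFourierCoeff_eq_zero hu m
  have hco := coord_of_kernel W hW B hB ν u D K x₀ hu hD hKw hcf w hw0
  have hwr : RapidDecay cf[((w : ℓ2) : (Fin 3 → ℤ) → ℂ³)] :=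
    rapidDecay_of_linearised_eq hν har hat (w : ℓ2) (W_trans hW w) hco
  by_contra hwne
  have hcfne : cf[((w : ℓ2) : (Fin 3 → ℤ) → ℂ³)] ≠ 0 := fun hz =>
    hwne (eq_zero_of_cf_eq_zero W hW w hz)
  have heqc : ∀ k : Fin 3 → ℤ,
      (((ν * (4 * Real.pi ^ 2 * freqNormSq k)) : ℝ) : ℂ) • cf[((w : ℓ2) : (Fin 3 → ℤ) → ℂ³)] k +
        lerayCoeff k (nl[mFourierCoeff (complexify ∘ u), cf[((w : ℓ2) : (Fin 3 → ℤ) → ℂ³)], k] +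
          nl[cf[((w : ℓ2) : (Fin 3 → ℤ) → ℂ³)], mFourierCoeff (complexify ∘ u), k]) = 0 := fun k => by
    rw [← smul_eq_weight_smul_cf (W_zero hW w) k]
    exact hco k
  exact hnd (isLinNSEigenvalue_of_fourier hu hdiv hwr (cf_transversal (W_trans hW w)) (cf_zero _) hcfne heqc)

end Summit.AnomalousDissipation.AnomalousDissipation.Theorems.WindLineWindyGalerkinSteadyZerothLaw
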